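import Literature.IUT.HodgeTheaters.Cor53iiiAtBadPlace
import Literature.IUT.HodgeTheaters.BadLocalFrobenioidDashSigmaLiftOrbit
import HarnessLib

/-!
# [IUTchI] Cor 5.3 (iii), BAD `⊢`-SLOT — the ORBIT rider: for every `β ∈ Aut(G_v̲)` ONE lift `Ψ` of `𝒞⊢_v̲` that preserves `τ⊢(q̲_v̲)` AND
# carries EVERY member `τ⊢(ζ·q̲_v̲)` of the `μ_{2l}`-orbit `τ⊢_v̲` to the member `τ⊢(σ_{β⁻¹}(ζ)·q̲_v̲)` of the same orbit (abc-iut-L5-t4, row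
# «COR53III-BAD-ORBIT», UPGRADE rider of the bad `⊢`-slot ★ `Cor53iiiAtBadPlace`; PROOF-ONLY — 0 def · 0 instance · 0 notation · no `Prop` fact)

S. Mochizuki, *Inter-universal Teichmüller theory I*, kurims manuscript (May 2020), §3 Example 3.2 (iv) p. 71: «`q̲_v` determines a
`μ_{2l}(−)`-orbit of characteristic splittings [cf. [FrdI], Definition 2.3] `τ⊢_v` on `𝒞⊢_v`»; Example 3.2 (v) p. 73: «Write `ℱ⊢_v := (𝒞⊢_v, τ⊢_v)`
for the resulting split Frobenioid»; §5 Corollary 5.3 (iii) p. 144 l. 16–19: «the natural map `Isom(¹𝔉⊢, ²𝔉⊢) → Isom(¹𝔇⊢, ²𝔇⊢)` […] is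
surjective». ([IUTchI] Cor 5.3 (iii) p.144; Ex 3.2 (iv) p.71) [claim: Mochizuki2012, status: disputed] (D-0012 claim key, series status DISPUTED —
THEOREMS about abc-iut's genuine bad-place construction and this seat's lift; nothing of the series is asserted; no side is taken on [IUTchIII] Cor. 3.12).

## What this file proves (cell abc-iut, L5 HUB node `IUTchI:Cor5.3(iii)`, bad `⊢`-slot CONTENT ENRICHMENT «orbit-faithful to Ex 3.2 (iv)»;
## abc-iut-L5-lead 2026-08-27 11:16:19Z GO (O1); count-neutral, not a flip precondition)

The bad `⊢`-slot of record (★ `Cor53iii.exists_badDashLift_frobeniusBadAt`, ★ p523255) lifts every `β ∈ Aut(G_v̲)` to a self-equivalence `Ψ` of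
`𝒞⊢_v̲` preserving the RECORDED MEMBER `τ⊢(q̲_v̲)` of `τ⊢_v̲`.  Print's `τ⊢_v̲` is the whole `μ_{2l}`-ORBIT `{τ⊢(ζ·q̲_v̲) : ζ^{2l} = 1}` (abc-iut-L5-t2
`BadLocalFrobenioid.tauDashOrbit`).  With the datum-level transport of the companion `BadLocalFrobenioidDashSigmaLiftOrbit`
(★ `BadDashSigmaLift.isPreservedBy_tauDashOf_unit_mul_lift`, `exists_unit_algebraMap_eq_sigma`):
* §B (MLF `k`, `σ := σ_{β⁻¹} = MLFSigma.sigma k β⁻¹`, exactly the `σ` of ★ `Cor53iiiAtBadPlace`): **`exists_badDashLift_orbit`** — for every `β` ONE `Ψ`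
  lying under `pullSelfEquiv β β⁻¹`, preserving `τ⊢(q̲)`, AND carrying every `τ⊢(ζ·q̲)` to `τ⊢(ζ'·q̲)` with `ζ' = σ_{β⁻¹}(ζ)` DISPLAYED
  (`K → k̄` applied to `ζ'` equals `MLFSigma.sigma k β⁻¹` applied to `ζ`) and `ζ^n = 1 ⇒ ζ'^n = 1`;
* §C (merge term, racer C's `D.frobeniusBadAt B I x hx`): **`exists_badDashLift_frobeniusBadAt_orbit`** — the same `Ψ` carries, for every `ζ` with
  `ζ^{2l} = 1`, the member `τ⊢(ζ·q̲_v̲)` of `(…).tauDashOrbit` to a MEMBER of `(…).tauDashOrbit` (the root `ζ'·q̲_v̲`, `(ζ' q̲_v̲)^{2l} = q_v̲`).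
CENSUS (#110 (4) grammar): binders {kit, `I`, `x`, `hx`, `β`} · LAW ∅ · FACT ∅ · side ∅ · DATA ∅.  NOT claimed: anything at the tempered side
`τ^Θ_v̲`; injectivity of `Isom(ℱ⊢) → Isom(𝒟⊢)`.  HONEST FRAMING: OUR lift on OUR carrier; typed ≠ inhabited ≠ proved beyond what is here; nothing
here asserts abc proved or refuted.
-/

noncomputable section

namespace Literature.IUT.HodgeTheaters

open CategoryTheory Opposite Literature.AnabelianGeometry.SemiGraphs Literature.AlgebraicGeometry.Frobenioids
open Literature.AlgebraicGeometry.Frobenioids.PadicFrd Literature.AnabelianGeometry.AbsoluteAnabelian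
open Literature.NumberTheory.GaloisRepresentations
open scoped ValuativeRel

/-! ### §B. At an MLF `k` with the anabelian `σ_{β⁻¹}`: ONE lift for `β`, member-faithful AND orbit-faithful -/

namespace Cor53iii

section GalAux

variable (k : Type) [Field k] (β : Field.absoluteGaloisGroup k ≃ₜ* Field.absoluteGaloisGroup k)

/-- `β ∘ β⁻¹ = id` on `Gal(k̄/k)`, as monoid homomorphisms. [folklore] -/
private theorem toMonoidHom_comp_symm' :
    ((β : Field.absoluteGaloisGroup k ≃* Field.absoluteGaloisGroup k) : Field.absoluteGaloisGroup k →* Field.absoluteGaloisGroup k).comp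
        ((β : Field.absoluteGaloisGroup k ≃* Field.absoluteGaloisGroup k).symm : Field.absoluteGaloisGroup k →* Field.absoluteGaloisGroup k) =
      MonoidHom.id _ :=
  MonoidHom.ext (β : Field.absoluteGaloisGroup k ≃* Field.absoluteGaloisGroup k).apply_symm_apply

/-- `β⁻¹ ∘ β = id` on `Gal(k̄/k)`, as monoid homomorphisms. [folklore] -/
private theorem symm_comp_toMonoidHom' :
    ((β : Field.absoluteGaloisGroup k ≃* Field.absoluteGaloisGroup k).symm : Field.absoluteGaloisGroup k →* Field.absoluteGaloisGroup k).comp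
        ((β : Field.absoluteGaloisGroup k ≃* Field.absoluteGaloisGroup k) : Field.absoluteGaloisGroup k →* Field.absoluteGaloisGroup k) =
      MonoidHom.id _ :=
  MonoidHom.ext (β : Field.absoluteGaloisGroup k ≃* Field.absoluteGaloisGroup k).symm_apply_apply

end GalAux

section Lift

variable (p : ℕ) [Fact p.Prime] (k : Type) [NontriviallyNormedField k] [CompleteSpace k] [IsUltrametricDist k]
  [NormedAlgebra ℚ_[p] k] [FiniteDimensional ℚ_[p] k] {q : intNonzero (GaloisValDatum.ofComplete p k).k} (hq : ¬ IsUnit q)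
  (β : Field.absoluteGaloisGroup k ≃ₜ* Field.absoluteGaloisGroup k)

/-- **[IUTchI] Cor 5.3 (iii) AT THE GENUINE BAD `⊢`-CARRIER OF AN MLF, ORBIT-FAITHFUL.**  For every `β ∈ Aut(G_v̲)` there is ONE self-equivalence `Ψ` of
`𝒞⊢_v̲ = (ofComplete p k).Cdash hq` LYING UNDER `pullSelfEquiv β β⁻¹`, preserving the recorded member `τ⊢(q̲)`, AND carrying, for EVERY unit `ζ` of `𝒪^⊳_k`,
the member `τ⊢(ζ·q̲)` to the member `τ⊢(ζ'·q̲)` where `ζ' = σ_{β⁻¹}(ζ)` (abc-iut-w4-d047 `MLFSigma.sigma k β⁻¹`, [AbsAnab] Prop 1.2.1 — DISPLAYED) is again a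
unit of `𝒪^⊳_k` with `ζ^n = 1 ⇒ ζ'^n = 1`: print's «`μ_{2l}`-orbit of characteristic splittings `τ⊢_v`» is carried onto itself member by member.
([IUTchI] Cor 5.3 (iii) p.144; Ex 3.2 (iv) p.71) [claim: Mochizuki2012, status: disputed] -/
theorem exists_badDashLift_orbit :
    letI := GaloisValDatum.normVal k
    haveI := GoodPlaceSigma.isNonarchimedeanLocalField p k
    haveI : CharZero k := GaloisValDatum.charZero p k
    ∃ Ψ : (GaloisValDatum.ofComplete p k).Cdash hq ≌ (GaloisValDatum.ofComplete p k).Cdash hq,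
      Nonempty (CatIsomorphism.LiesUnder ((GaloisValDatum.ofComplete p k).CdashBase hq) ((GaloisValDatum.ofComplete p k).CdashBase hq) Ψ
        (PiTransport.pullSelfEquiv _ _ β.continuous β.symm.continuous (toMonoidHom_comp_symm' k β) (symm_comp_toMonoidHom' k β))) ∧
      ((GaloisValDatum.ofComplete p k).tauDashOf hq q).IsPreservedBy ((GaloisValDatum.ofComplete p k).tauDashOf hq q) Ψ.functor ∧
      ∀ ζ : (intNonzero (GaloisValDatum.ofComplete p k).k)ˣ, ∃ ζ' : (intNonzero (GaloisValDatum.ofComplete p k).k)ˣ,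
        Units.map (algebraMap (GaloisValDatum.ofComplete p k).k (GaloisValDatum.ofComplete p k).Ω :
            (GaloisValDatum.ofComplete p k).k →* (GaloisValDatum.ofComplete p k).Ω)
            (intNonzeroToUnits (GaloisValDatum.ofComplete p k).k (ζ' : intNonzero (GaloisValDatum.ofComplete p k).k)) =
          MLFSigma.sigma k β.symm
            (Units.map (algebraMap (GaloisValDatum.ofComplete p k).k (GaloisValDatum.ofComplete p k).Ω :
              (GaloisValDatum.ofComplete p k).k →* (GaloisValDatum.ofComplete p k).Ω)
              (intNonzeroToUnits (GaloisValDatum.ofComplete p k).k (ζ : intNonzero (GaloisValDatum.ofComplete p k).k))) ∧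
        (∀ n : ℕ, ζ ^ n = 1 → ζ' ^ n = 1) ∧
        ((GaloisValDatum.ofComplete p k).tauDashOf hq ((ζ : intNonzero (GaloisValDatum.ofComplete p k).k) * q)).IsPreservedBy
          ((GaloisValDatum.ofComplete p k).tauDashOf hq ((ζ' : intNonzero (GaloisValDatum.ofComplete p k).k) * q)) Ψ.functor := by
  letI := GaloisValDatum.normVal k
  haveI := GoodPlaceSigma.isNonarchimedeanLocalField p k
  haveI : CharZero k := GaloisValDatum.charZero p k
  letI : ValuativeRel (AlgebraicClosure k) := (GaloisValDatum.ofComplete p k).valΩ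
  let βm : (AlgebraicClosure k ≃ₐ[k] AlgebraicClosure k) ≃* (AlgebraicClosure k ≃ₐ[k] AlgebraicClosure k) :=
    (β : Field.absoluteGaloisGroup k ≃* Field.absoluteGaloisGroup k)
  have hβc : Continuous βm := β.continuous
  have hβc' : Continuous βm.symm := β.symm.continuous
  let σ : (AlgebraicClosure k)ˣ →* (AlgebraicClosure k)ˣ := (MLFSigma.sigma k β.symm).toMonoidHom
  let σ' : (AlgebraicClosure k)ˣ →* (AlgebraicClosure k)ˣ := (MLFSigma.sigma k β).toMonoidHom
  have hσ : ∀ (γ : AlgebraicClosure k ≃ₐ[k] AlgebraicClosure k) (y : (AlgebraicClosure k)ˣ), σ (γ • y) = βm.symm γ • σ y :=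
    fun γ y => MLFSigma.sigma_smul k β.symm γ y
  have hσ' : ∀ (γ : AlgebraicClosure k ≃ₐ[k] AlgebraicClosure k) (y : (AlgebraicClosure k)ˣ), σ' (γ • y) = βm γ • σ' y :=
    fun γ y => MLFSigma.sigma_smul k β γ y
  have hinv : ∀ y, σ' (σ y) = y := fun y => by
    change MLFSigma.sigma k β (MLFSigma.sigma k β.symm y) = y
    rw [MLFSigma.sigma_symm, MulEquiv.apply_symm_apply]
  have hinv' : ∀ y, σ (σ' y) = y := fun y => by
    change MLFSigma.sigma k β.symm (MLFSigma.sigma k β y) = y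
    rw [MLFSigma.sigma_symm, MulEquiv.symm_apply_apply]
  have hσint : ∀ y : (AlgebraicClosure k)ˣ, ValuativeRel.valuation (AlgebraicClosure k) (y : AlgebraicClosure k) ≤ 1 →
      ValuativeRel.valuation (AlgebraicClosure k) (σ y : AlgebraicClosure k) ≤ 1 := fun y hy => valuation_sigma_le_one p k β.symm y hy
  have hσ'int : ∀ y : (AlgebraicClosure k)ˣ, ValuativeRel.valuation (AlgebraicClosure k) (y : AlgebraicClosure k) ≤ 1 →
      ValuativeRel.valuation (AlgebraicClosure k) (σ' y : AlgebraicClosure k) ≤ 1 := fun y hy => valuation_sigma_le_one p k β y hy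
  have hσq : ∀ y : (AlgebraicClosure k)ˣ, (y : AlgebraicClosure k) = algebraMap k (AlgebraicClosure k) (q.1 : k) →
      ValuativeRel.valuation (AlgebraicClosure k) (σ y : AlgebraicClosure k) =
        ValuativeRel.valuation (AlgebraicClosure k) (algebraMap k (AlgebraicClosure k) (q.1 : k)) :=
    fun y hy => valuation_sigma_eq_of_coe_eq_algebraMap p k β.symm y (q.1 : k) hy q.2.1
  have hσ'q : ∀ y : (AlgebraicClosure k)ˣ, (y : AlgebraicClosure k) = algebraMap k (AlgebraicClosure k) (q.1 : k) →
      ValuativeRel.valuation (AlgebraicClosure k) (σ' y : AlgebraicClosure k) =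
        ValuativeRel.valuation (AlgebraicClosure k) (algebraMap k (AlgebraicClosure k) (q.1 : k)) :=
    fun y hy => valuation_sigma_eq_of_coe_eq_algebraMap p k β y (q.1 : k) hy q.2.1
  obtain ⟨Ψ, hΨ, hlies⟩ := BadDashSigmaLift.exists_selfEquivalence_liesUnder_pullSelfEquiv (GaloisValDatum.ofComplete p k) hq βm hβc σ hσ
    hσint hσq hβc' σ' hσ' hσ'int hσ'q hinv hinv'
  refine ⟨Ψ, hlies, ?_, fun ζ => ?_⟩
  · rw [hΨ]
    exact BadDashSigmaLift.isPreservedBy_tauDashOf_self_lift (GaloisValDatum.ofComplete p k) hq βm hβc σ hσ hσint hσq hβc' σ' hσ' hσ'int hσ'q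
      hinv hinv'
  · obtain ⟨ζ', h1, h2⟩ := BadDashSigmaLift.exists_unit_algebraMap_eq_sigma (GaloisValDatum.ofComplete p k) βm σ hσ hσint ζ
    refine ⟨ζ', h1, h2, ?_⟩
    rw [hΨ]
    exact BadDashSigmaLift.isPreservedBy_tauDashOf_unit_mul_lift (GaloisValDatum.ofComplete p k) hq βm hβc σ hσ hσint hσq hβc' σ' hσ' hσ'int
      hσ'q hinv hinv' ζ ζ' h1

end Lift

/-! ### §C. At the merge term: racer C's `frobeniusBadAt`, orbit to orbit -/

section AtTerm

variable {F K Fbar : Type} [Field F] [NumberField F] [Field K] [NumberField K] [Algebra F K]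
  [Field Fbar] [Algebra F Fbar] [Algebra K Fbar]
  {E : WeierstrassCurve F} [E.IsElliptic] {l : ℕ} {Pb : BadPlacePredicates K}
  (D : InitialThetaData F K Fbar E l Pb)
  (B : ∀ v, v ∈ D.indexCopyBad → D.BadPairAt v) (I : D.MergeInputs B) (x : D.IndexCopy) (hx : x ∈ D.indexCopyBad)
  (β : Field.absoluteGaloisGroup (D.KvAt x (D.not_mem_arc_of_mem_bad hx)) ≃ₜ* Field.absoluteGaloisGroup (D.KvAt x (D.not_mem_arc_of_mem_bad hx)))

/-- **[IUTchI] Cor 5.3 (iii), BAD `⊢`-SLOT AT THE MERGE TERM, ORBIT-FAITHFUL.**  At every bad index `x` of the genuine `ℱ`-kit of record, for EVERY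
`β ∈ Aut(G_v̲)` there is ONE self-equivalence `Ψ` of `(D.frobeniusBadAt B I x hx).Cdash` lying under `pullSelfEquiv β β⁻¹` through `(…).CdashBase`,
preserving the recorded member `(…).tauDash = τ⊢(q̲_v̲)`, AND carrying, for every `2l`-th root of unity `ζ ∈ 𝒪^⊳_{K_v̲}`, the member `τ⊢(ζ·q̲_v̲)` of
print's orbit `τ⊢_v̲ = (…).tauDashOrbit` to a MEMBER of `(…).tauDashOrbit` (namely `τ⊢(σ_{β⁻¹}(ζ)·q̲_v̲)`, §B).  Binders {`B`, `I`, `x`, `hx`, `β`} only: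
LAW ∅ · FACT ∅ · side ∅. ([IUTchI] Cor 5.3 (iii) p.144; Ex 3.2 (iv) p.71) [claim: Mochizuki2012, status: disputed] -/
theorem exists_badDashLift_frobeniusBadAt_orbit :
    haveI := D.fact_primeAt_prime x (D.not_mem_arc_of_mem_bad hx)
    ∃ Ψ : (D.frobeniusBadAt B I x hx).Cdash ≌ (D.frobeniusBadAt B I x hx).Cdash,
      Nonempty (CatIsomorphism.LiesUnder (D.frobeniusBadAt B I x hx).CdashBase (D.frobeniusBadAt B I x hx).CdashBase Ψ
        (PiTransport.pullSelfEquiv _ _ β.continuous β.symm.continuous (toMonoidHom_comp_symm' (D.KvAt x (D.not_mem_arc_of_mem_bad hx)) β)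
          (symm_comp_toMonoidHom' (D.KvAt x (D.not_mem_arc_of_mem_bad hx)) β))) ∧
      (D.frobeniusBadAt B I x hx).tauDash.IsPreservedBy (D.frobeniusBadAt B I x hx).tauDash Ψ.functor ∧
      ∀ ζ : (intNonzero (D.gvdAt x (D.not_mem_arc_of_mem_bad hx)).k)ˣ, ζ ^ (2 * l) = 1 →
        ∃ τ' ∈ (D.frobeniusBadAt B I x hx).tauDashOrbit,
          ((D.frobeniusBadAt B I x hx).tauDashOf
              ((ζ : intNonzero (D.gvdAt x (D.not_mem_arc_of_mem_bad hx)).k) * (D.frobeniusBadAt B I x hx).qroot)).IsPreservedBy τ' Ψ.functor := by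
  haveI : Fact (D.primeAt x (D.not_mem_arc_of_mem_bad hx)).Prime := D.fact_primeAt_prime x _
  haveI := GaloisValDatum.finiteDimensional_rescaledCompletion K (D.primeAt x (D.not_mem_arc_of_mem_bad hx))
    (D.specAt x (D.not_mem_arc_of_mem_bad hx)) (D.primeAt_mem x (D.not_mem_arc_of_mem_bad hx))
  obtain ⟨Ψ, hlies, hτ, horb⟩ :=
    exists_badDashLift_orbit (D.primeAt x (D.not_mem_arc_of_mem_bad hx)) (D.KvAt x (D.not_mem_arc_of_mem_bad hx)) (D.qRootAtIdx_not_isUnit x hx) β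
  refine ⟨Ψ, hlies, hτ, fun ζ hζ => ?_⟩
  obtain ⟨ζ', -, h2, h3⟩ := horb ζ
  -- the witness root `ζ'·q̲_v̲` is read off `h3` by unification
  refine ⟨_, ⟨_, ?_, rfl⟩, h3⟩
  exact (BadDashSigmaLift.units_val_mul_pow_eq_of_pow_eq_one ζ' _ _ (h2 _ hζ)).trans (D.frobeniusBadAt B I x hx).qroot_pow

end AtTerm

end Cor53iii

end Literature.IUT.HodgeTheaters

end
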